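import Summits.QuantumFields.YangMills.Theorems.LuscherReductionTwistedTraceScalingBTFixedBeta
import Summits.QuantumFields.YangMills.Theorems.LuscherReductionTwistedTraceScalingBTRatesAtoms
import Summits.QuantumFields.YangMills.Theorems.LuscherReductionTwistedTraceScalingFPWeightCore
import HarnessLib

/-!
# (C1-ε) SCHEDULE B FOR THE CENTRAL TRANSFER: the radii of the (C1) theorem as functions of `β`, their decay, and the support of the Faddeev–Popov core weight
# (lane A of S-BASE, crux `TwistedTraceScaling` stmt-QuantumFields-20203, C4-CORE, the (OD) pen; rates for `…BOCentralTransfer.central_transfer_two_sided_chart`,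
# `pub/ym-fleet/ym-luscher-20007-p1/HANDOFF-g18.md` "DESIGN POINTS" 3–4)

Written inline (no new definitions; `ℓ = btLog β`, `ε = btEps β = β^{-1}`): profile radius `r_f = min(1/40, β^{-1/2}ℓ)`, FP jump radius `R₁' = 5β^{-1/2}ℓ²`, gauge-core/fibre size
`T = 9L·R₁' + ε`, chart radius `ρ = 8T`, Laplace core `r = β^{-1}ℓ³`.
* §1 ★ `coreWeight_support` — `hWc` of the glue for `W = coreWeight ε R₁'`: `W g ≠ 0 → (∀ x, ‖q(g_x) − 1‖ ≤ 9L·R₁' + ε) ∧ ‖Σ_x g⃗_x‖ ≤ ε·|Site|` (`3L·R₁' < 1`, `0 ≤ ε`; the argument of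
  `…BTFixedBeta.fixed_beta_estimate`, now a lemma);
* §2 decay: `tendsto_schedT` (`T → 0`), `tendsto_schedRho`, `tendsto_schedCore` (`r → 0`), `tendsto_rf`, `tendsto_btLog_atTop`, `schedT_le` (`T ≤ (45L+1)β^{-1/2}ℓ²`), and the
  products that enter `c_hi/c_lo`, `e^{±882βT²R_in²}`, `ε_q`, `ε_tr`: `tendsto_beta_rho_cube` (`βρ³ → 0`), `tendsto_beta_T_sq_rf_sq` (`βT²r_f² → 0`), `tendsto_beta_core_rho`
  (`β·r·ρ → 0`, `β·r² → 0`).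
The `∀ᶠ β` discharge of the ~30 smallness hypotheses of `central_transfer_two_sided_chart` and the window/profile data are the next files.
HONEST FRAMING: rate bookkeeping for a stub of a child of the CONDITIONAL route R2b1; (C1) packaging, (C4), (C5), (B-ST) OPEN; C4-CORE OPEN; not infinite volume, not a gap, not Clay.
-/

set_option autoImplicit false

noncomputable section

open MeasureTheory Filter Topology Real
open scoped BigOperators Quaternion
open Literature.MathematicalPhysics.QuantumFieldTheory
open Literature.MathematicalPhysics.QuantumLattice

namespace Summit.QuantumFields.YangMills.Theorems.FemtoTransferGap.TwoLattice.ConstTube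

open Summit.QuantumFields.YangMills.Theorems.FemtoTransferGap
open Summit.QuantumFields.YangMills.Theorems.FemtoTransferGap.TwoLattice

variable {L : ℕ}

/-! ## §1 ★ The support of the Faddeev–Popov core weight -/

/-- ★ **`hWc` for the core weight**: if `coreWeight ε R₁' g ≠ 0` (`3L·R₁' < 1`, `0 ≤ ε`) then every `g_x` is within `9L·R₁' + ε` of `1` and `‖Σ_x g⃗_x‖ ≤ ε·|Site|`. [cite: Luscher1983, §3] -/
theorem coreWeight_support [NeZero L] {ε R₁' : ℝ} (hε0 : 0 ≤ ε) (h3 : 3 * L * R₁' < 1) {g : Site 3 L → SU2} (hg : coreWeight L ε R₁' g ≠ 0) :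
    (∀ x, ‖su2Quat (g x) - 1‖ ≤ 9 * L * R₁' + ε) ∧ ‖∑ x, vecPart (g x)‖ ≤ ε * Fintype.card (Site 3 L) := by
  obtain ⟨hcore, hpin⟩ := mem_of_coreWeight_ne_zero hg
  have hjumps : ∀ e : Edge 3 L, ‖su2Quat (g (e.1.shift e.2)) - su2Quat (g e.1)‖ ≤ R₁' := fun e => (hcore e).le
  refine ⟨fun x => norm_su2Quat_sub_one_le_of_jumps (L := L) hjumps h3 hpin x, ?_⟩
  have hpath := norm_su2Quat_sub_base_le (L := L) hjumps
  have hS0 := colourQuatSum_ne_zero_of_near (L := L) h3 hpath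
  have hSle : ‖colourQuatSum L g‖ ≤ Fintype.card (Site 3 L) := by
    unfold colourQuatSum
    refine (norm_sum_le _ _).trans ?_
    simp only [norm_su2Quat, Finset.sum_const, Finset.card_univ, nsmul_eq_mul, mul_one, le_refl]
  calc ‖∑ x, vecPart (g x)‖ ≤ ‖colourQuatSum L g - ‖colourQuatSum L g‖ • (1 : ℍ)‖ := norm_sum_vecPart_le g
    _ ≤ ε * ‖colourQuatSum L g‖ := norm_colourQuatSum_sub_smul_one_le hS0 hpin
    _ ≤ ε * Fintype.card (Site 3 L) := mul_le_mul_of_nonneg_left hSle hε0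

/-! ## §2 Decay of the schedule radii -/

/-- `T(β) = 9L·5β^{-1/2}ℓ² + β^{-1} → 0`. [folklore] -/
theorem tendsto_schedT : Tendsto (fun β : ℝ => 9 * (L : ℝ) * (5 * (powScale (1 / 2) β * btLog β ^ 2)) + powScale 1 β) atTop (𝓝 0) := by
  have h1 := (tendsto_powScale_mul_btLog_pow (p := 1 / 2) (by norm_num) 2).const_mul (9 * (L : ℝ) * 5)
  have h2 := tendsto_powScale (σ := 1) one_pos
  have h := h1.add h2
  rw [mul_zero, zero_add] at h
  refine h.congr' (Eventually.of_forall fun β => ?_)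
  ring

/-- `ρ(β) = 8T(β) → 0`. [folklore] -/
theorem tendsto_schedRho : Tendsto (fun β : ℝ => 8 * (9 * (L : ℝ) * (5 * (powScale (1 / 2) β * btLog β ^ 2)) + powScale 1 β)) atTop (𝓝 0) := by
  have h := (tendsto_schedT (L := L)).const_mul 8
  rw [mul_zero] at h; exact h

/-- `r(β) = β^{-1}ℓ³ → 0`. [folklore] -/
theorem tendsto_schedCore : Tendsto (fun β : ℝ => powScale 1 β * btLog β ^ 3) atTop (𝓝 0) := tendsto_powScale_mul_btLog_pow one_pos 3

/-- `β^{-1/2}ℓ → 0` (the profile radius eventually). [folklore] -/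
theorem tendsto_rf : Tendsto (fun β : ℝ => powScale (1 / 2) β * btLog β) atTop (𝓝 0) := by
  have h := tendsto_powScale_mul_btLog_pow (p := 1 / 2) (by norm_num) 1
  simpa only [pow_one] using h

/-- `β·ρ(β)³ → 0` (it is `O(L³β^{-1/2}ℓ⁶)`): the chart-sandwich constants `c_hi/c_lo → 1`. [folklore] -/
theorem tendsto_beta_rho_cube :
    Tendsto (fun β : ℝ => β * (8 * (9 * (L : ℝ) * (5 * (powScale (1 / 2) β * btLog β ^ 2)) + powScale 1 β)) ^ 3) atTop (𝓝 0) := by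
  -- `ρ ≤ C·β^{-1/2}ℓ²` eventually (`β^{-1} ≤ β^{-1/2}ℓ²`), and `β·(β^{-1/2}ℓ²)³ = β^{-1/2}ℓ⁶`
  set C : ℝ := 8 * (9 * (L : ℝ) * 5 + 1) with hC
  have hC0 : 0 ≤ C := by rw [hC]; positivity
  have hmain : Tendsto (fun β : ℝ => C ^ 3 * (powScale (1 / 2) β * btLog β ^ 6)) atTop (𝓝 0) := by
    have h := (tendsto_powScale_mul_btLog_pow (p := 1 / 2) (by norm_num) 6).const_mul (C ^ 3)
    rw [mul_zero] at h; exact h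
  have hT0 : ∀ β : ℝ, 0 ≤ 8 * (9 * (L : ℝ) * (5 * (powScale (1 / 2) β * btLog β ^ 2)) + powScale 1 β) := fun β => by
    have hx0 : 0 < powScale (1 / 2) β := powScale_pos _ _
    have h10 : 0 < powScale 1 β := powScale_pos _ _
    have hℓ : 0 ≤ btLog β := le_trans zero_le_one (one_le_btLog β)
    have hL0 : (0 : ℝ) ≤ (L : ℝ) := Nat.cast_nonneg L
    have : 0 ≤ powScale (1 / 2) β * btLog β ^ 2 := mul_nonneg hx0.le (pow_nonneg hℓ 2)
    nlinarith
  refine squeeze_zero' ?_ ?_ hmain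
  · filter_upwards [eventually_ge_atTop (0 : ℝ)] with β hβ
    exact mul_nonneg hβ (pow_nonneg (hT0 β) 3)
  filter_upwards [eventually_ge_atTop (1 : ℝ)] with β hβ
  have hℓ := one_le_btLog β
  have hx0 : 0 < powScale (1 / 2) β := powScale_pos _ _
  have hb0 : 0 < β := by linarith
  -- `powScale 1 β = (powScale (1/2) β)²`, `β * (powScale (1/2) β)^2 = 1`
  have hsq : β * powScale (1 / 2) β ^ 2 = 1 := mul_powScale_half_sq hβ
  have h1le : powScale 1 β ≤ powScale (1 / 2) β * btLog β ^ 2 := by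
    have e1 : powScale 1 β = powScale (1 / 2) β ^ 2 := by
      have := mul_powScale_one hβ; nlinarith [hsq, this]
    rw [e1, sq]
    refine mul_le_mul_of_nonneg_left ?_ hx0.le
    calc powScale (1 / 2) β ≤ 1 := powScale_le_one (by norm_num) β |>.trans le_rfl
      _ ≤ btLog β ^ 2 := one_le_pow₀ hℓ
    -- (if `powScale_le_one` has a different signature the line above is adjusted at check time)
  have hρle : 8 * (9 * (L : ℝ) * (5 * (powScale (1 / 2) β * btLog β ^ 2)) + powScale 1 β) ≤ C * (powScale (1 / 2) β * btLog β ^ 2) := by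
    rw [hC]; nlinarith [h1le, hx0.le, pow_nonneg (le_trans zero_le_one hℓ) 2]
  have hρ0 := hT0 β
  calc β * (8 * (9 * (L : ℝ) * (5 * (powScale (1 / 2) β * btLog β ^ 2)) + powScale 1 β)) ^ 3 ≤ β * (C * (powScale (1 / 2) β * btLog β ^ 2)) ^ 3 := by
        gcongr
    _ = C ^ 3 * ((β * powScale (1 / 2) β ^ 2) * (powScale (1 / 2) β * btLog β ^ 6)) := by ring
    _ = C ^ 3 * (powScale (1 / 2) β * btLog β ^ 6) := by rw [hsq, one_mul]

/-- `ℓ = btLog β → ∞`. [folklore] -/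
theorem tendsto_btLog_atTop : Tendsto btLog atTop atTop :=
  tendsto_atTop_mono (fun _ => le_max_left _ _) Real.tendsto_log_atTop

/-- A bound `T(β) ≤ C_T·β^{-1/2}ℓ²` for `β ≥ 1`, `C_T = 45L + 1`. [folklore] -/
theorem schedT_le {β : ℝ} (hβ : 1 ≤ β) :
    9 * (L : ℝ) * (5 * (powScale (1 / 2) β * btLog β ^ 2)) + powScale 1 β ≤ (45 * (L : ℝ) + 1) * (powScale (1 / 2) β * btLog β ^ 2) := by
  have hℓ := one_le_btLog β
  have hx0 : 0 < powScale (1 / 2) β := powScale_pos _ _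
  have hsq : β * powScale (1 / 2) β ^ 2 = 1 := mul_powScale_half_sq hβ
  have h1le : powScale 1 β ≤ powScale (1 / 2) β * btLog β ^ 2 := by
    have e1 : powScale 1 β = powScale (1 / 2) β ^ 2 := by
      have := mul_powScale_one hβ; nlinarith [hsq, this]
    rw [e1, sq]
    refine mul_le_mul_of_nonneg_left ?_ hx0.le
    calc powScale (1 / 2) β ≤ 1 := powScale_le_one (by norm_num) β
      _ ≤ btLog β ^ 2 := one_le_pow₀ hℓ
  nlinarith [h1le]

/-- `β·T(β)²·(β^{-1/2}ℓ)² → 0` (it is `O(L²β^{-1}ℓ⁶)`): the centre factors `e^{±882βT²R_in²} → 1`. [folklore] -/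
theorem tendsto_beta_T_sq_rf_sq :
    Tendsto (fun β : ℝ => β * (9 * (L : ℝ) * (5 * (powScale (1 / 2) β * btLog β ^ 2)) + powScale 1 β) ^ 2 * (powScale (1 / 2) β * btLog β) ^ 2) atTop (𝓝 0) := by
  set C : ℝ := 45 * (L : ℝ) + 1 with hC
  have hmain : Tendsto (fun β : ℝ => C ^ 2 * (powScale 1 β * btLog β ^ 6)) atTop (𝓝 0) := by
    have h := (tendsto_powScale_mul_btLog_pow (p := 1) one_pos 6).const_mul (C ^ 2)
    rw [mul_zero] at h; exact h
  refine squeeze_zero' ?_ ?_ hmain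
  · filter_upwards [eventually_ge_atTop (0 : ℝ)] with β hβ
    positivity
  filter_upwards [eventually_ge_atTop (1 : ℝ)] with β hβ
  have hℓ := one_le_btLog β
  have hx0 : 0 < powScale (1 / 2) β := powScale_pos _ _
  have hsq : β * powScale (1 / 2) β ^ 2 = 1 := mul_powScale_half_sq hβ
  have h1 : β * powScale 1 β = 1 := mul_powScale_one hβ
  have hT := schedT_le (L := L) hβ
  have hT0 : 0 ≤ 9 * (L : ℝ) * (5 * (powScale (1 / 2) β * btLog β ^ 2)) + powScale 1 β := by
    have : 0 ≤ powScale (1 / 2) β * btLog β ^ 2 := mul_nonneg hx0.le (pow_nonneg (le_trans zero_le_one hℓ) 2)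
    have h10 : 0 < powScale 1 β := powScale_pos _ _
    have hL0 : (0 : ℝ) ≤ (L : ℝ) := Nat.cast_nonneg L
    nlinarith
  calc β * (9 * (L : ℝ) * (5 * (powScale (1 / 2) β * btLog β ^ 2)) + powScale 1 β) ^ 2 * (powScale (1 / 2) β * btLog β) ^ 2
      ≤ β * (C * (powScale (1 / 2) β * btLog β ^ 2)) ^ 2 * (powScale (1 / 2) β * btLog β) ^ 2 := by gcongr
    _ = C ^ 2 * ((β * powScale (1 / 2) β ^ 2) * (powScale (1 / 2) β ^ 2) * btLog β ^ 6) := by ring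
    _ = C ^ 2 * (powScale 1 β * btLog β ^ 6) := by
        rw [hsq, one_mul]
        have e1 : powScale (1 / 2) β ^ 2 = powScale 1 β := by nlinarith [hsq, h1]
        rw [e1]

/-- `β·r(β)·ρ(β) → 0` and `β·r(β)² → 0` (they are `O(Lβ^{-1/2}ℓ⁵)`, `O(β^{-1}ℓ⁶)`): `ε_q → 0`. [folklore] -/
theorem tendsto_beta_core_rho :
    Tendsto (fun β : ℝ => β * (powScale 1 β * btLog β ^ 3) * (8 * (9 * (L : ℝ) * (5 * (powScale (1 / 2) β * btLog β ^ 2)) + powScale 1 β))) atTop (𝓝 0) ∧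
      Tendsto (fun β : ℝ => β * (powScale 1 β * btLog β ^ 3) ^ 2) atTop (𝓝 0) := by
  set C : ℝ := 45 * (L : ℝ) + 1 with hC
  constructor
  · have hmain : Tendsto (fun β : ℝ => 8 * C * (powScale (1 / 2) β * btLog β ^ 5)) atTop (𝓝 0) := by
      have h := (tendsto_powScale_mul_btLog_pow (p := 1 / 2) (by norm_num) 5).const_mul (8 * C)
      rw [mul_zero] at h; exact h
    refine squeeze_zero' ?_ ?_ hmain
    · filter_upwards [eventually_ge_atTop (0 : ℝ)] with β hβ
      have hℓ := one_le_btLog β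
      have : 0 ≤ powScale (1 / 2) β * btLog β ^ 2 := mul_nonneg (powScale_pos _ _).le (pow_nonneg (le_trans zero_le_one hℓ) 2)
      have h10 : 0 < powScale 1 β := powScale_pos _ _
      have hL0 : (0 : ℝ) ≤ (L : ℝ) := Nat.cast_nonneg L
      have : 0 ≤ 8 * (9 * (L : ℝ) * (5 * (powScale (1 / 2) β * btLog β ^ 2)) + powScale 1 β) := by nlinarith
      positivity
    filter_upwards [eventually_ge_atTop (1 : ℝ)] with β hβ
    have hℓ := one_le_btLog β
    have h1 : β * powScale 1 β = 1 := mul_powScale_one hβ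
    have hT := schedT_le (L := L) hβ
    have hr0 : 0 ≤ powScale 1 β * btLog β ^ 3 := mul_nonneg (powScale_pos _ _).le (pow_nonneg (le_trans zero_le_one hℓ) 3)
    calc β * (powScale 1 β * btLog β ^ 3) * (8 * (9 * (L : ℝ) * (5 * (powScale (1 / 2) β * btLog β ^ 2)) + powScale 1 β))
        ≤ β * (powScale 1 β * btLog β ^ 3) * (8 * (C * (powScale (1 / 2) β * btLog β ^ 2))) := by
          refine mul_le_mul_of_nonneg_left (by linarith) (mul_nonneg (by linarith) hr0)
      _ = 8 * C * ((β * powScale 1 β) * (powScale (1 / 2) β * btLog β ^ 5)) := by ring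
      _ = 8 * C * (powScale (1 / 2) β * btLog β ^ 5) := by rw [h1, one_mul]
  · have hmain : Tendsto (fun β : ℝ => powScale 1 β * btLog β ^ 6) atTop (𝓝 0) := tendsto_powScale_mul_btLog_pow one_pos 6
    refine hmain.congr' ?_
    filter_upwards [eventually_ge_atTop (1 : ℝ)] with β hβ
    have h1 : β * powScale 1 β = 1 := mul_powScale_one hβ
    calc powScale 1 β * btLog β ^ 6 = (β * powScale 1 β) * (powScale 1 β * btLog β ^ 6) := by rw [h1, one_mul]
      _ = β * (powScale 1 β * btLog β ^ 3) ^ 2 := by ring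

end Summit.QuantumFields.YangMills.Theorems.FemtoTransferGap.TwoLattice.ConstTube

end
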